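import Mathlib
import HarnessLib
import Literature.MathematicalPhysics.QuantumFieldTheory.YangMillsOS
import Literature.MathematicalPhysics.QuantumFieldTheory.Sweep1
import Literature.MathematicalPhysics.QuantumFieldTheory.Sweep1AreaLawProofs
import Summits.QuantumFields.YangMills.Theorems.PencilRigidityCurvatureKernelBoundSwapReflectionPositivity
import Summits.QuantumFields.YangMills.Theorems.PencilRigidityCurvatureKernelBoundCurvatureSwapCovariance

/-!
# `CurvatureKernelBound` — brick `SmearedSwapObservables` of lead c10's swap-mirror programme toward `Stub.FiniteCouplingStrongSubextensive`
# (crux stmt-QuantumFields-11687, line `coupling-trichotomy`, skeleton v9, wave 2)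

Bookkeeping for the reflection-positivity argument across the diagonal mirror `{x i = x j}` of
`ℤ⁴` (`(ΘU)(x, k) = U(x ∘ swap i j, swap i j k)` on configurations):

* `ZdExpectSwapInvariant`: the free-boundary Wilson expectation on the cube `{-L,…,L}⁴` is
  `Θ`-invariant, `⟨F ∘ Θ⟩_{Λ_L,β} = ⟨F⟩_{Λ_L,β}` for EVERY `F` — `Θ` is a coordinate relabelling of
  the i.i.d. Haar product `dg_∞` by an involution of the edges (Mathlib's
  `Measure.infinitePi_map_piCongrLeft`), hence a measure-preserving measurable equivalence, and the
  Wilson action of the swap-symmetric box is `Θ`-invariant (the plaquette reflection permutes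
  `plaquettesIn (box 4 L)`, characters are real on inverses); the expectation is the ratio
  `∫ F e^{-βS} dg_∞ / ∫ e^{-βS} dg_∞` (`AreaLaw.zdExpect_eq_div_integral`).
* `SmearedPositiveHalfSupport`: the curvature field smeared against a test function supported in
  `{z i - z j ≥ δ}` at spacing `0 < a ≤ δ` is a bounded measurable function of finitely many links
  with both endpoints in the closed positive half `x j ≤ x i` (contributing sites have level
  `x i - x j ≥ 1`, the links of the six origin plaquettes translated to `x` lose at most one level).
* `SmearedTranslate`: smearing against `g` after translating the configuration by `w` is smearing
  against the translated test function `g' = g(· - a w)` (reindexing the lattice sum, which stays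
  inside the box on the support of `g`).
-/

noncomputable section

open scoped BigOperators Topology SchwartzMap
open MeasureTheory Filter Set
open Literature.MathematicalPhysics.QuantumLattice Literature.MathematicalPhysics.QuantumFieldTheory
  Literature.Probability.LatticeModels

namespace Summit.QuantumFields.YangMills.Theorems.CurvatureKernel

namespace SwapRP

/-! ## `Θ`-invariance of the Wilson action of the box and of `dg_∞` -/

section SwapInvariance

variable {G : Type*} [Group G] [TopologicalSpace G] [IsTopologicalGroup G] [CompactSpace G]
variable {N : ℕ} (ρ : G →* Matrix (Fin N) (Fin N) ℂ)

/-- The Wilson action of the swap-symmetric box is invariant under the configuration swap `Θ`: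
the plaquette reflection (base point swapped, plane pair swapped and re-sorted) permutes
`plaquettesIn (box 4 L)` and `Re tr ρ` does not see the orientation reversal. [folklore] -/
theorem zdWilsonAction_swapCfg (hρ : Continuous ρ) (i j : Fin 4) (L : ℕ) (U : ZdGaugeConfig 4 G) :
    zdWilsonAction ρ (box 4 L) (fun e : Site 4 × Fin 4 => U (e.1 ∘ Equiv.swap i j,
        Equiv.swap i j e.2)) = zdWilsonAction ρ (box 4 L) U := by
  unfold zdWilsonAction
  calc ∑ p ∈ plaquettesIn (box 4 L), ((N : ℝ) - (ρ (ZdGaugeConfig.plaquette (fun e : Site 4 × Fin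
          4 => U (e.1 ∘ Equiv.swap i j, Equiv.swap i j e.2)) p.1 p.2.1 p.2.2)).trace.re)
      = ∑ p ∈ plaquettesIn (box 4 L), ((N : ℝ) - (ρ (ZdGaugeConfig.plaquette U ((if Equiv.swap i j
          p.2.1 < Equiv.swap i j p.2.2 then (p.1 ∘ Equiv.swap i j, Equiv.swap i j p.2.1, Equiv.swap
          i j p.2.2) else (p.1 ∘ Equiv.swap i j, Equiv.swap i j p.2.2, Equiv.swap i j p.2.1) :
          Site 4 × Fin 4 × Fin 4)).1 ((if Equiv.swap i j p.2.1 < Equiv.swap i j p.2.2 then (p.1 ∘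
          Equiv.swap i j, Equiv.swap i j p.2.1, Equiv.swap i j p.2.2) else (p.1 ∘ Equiv.swap i j,
          Equiv.swap i j p.2.2, Equiv.swap i j p.2.1) : Site 4 × Fin 4 × Fin 4)).2.1 ((if
          Equiv.swap i j p.2.1 < Equiv.swap i j p.2.2 then (p.1 ∘ Equiv.swap i j, Equiv.swap i j
          p.2.1, Equiv.swap i j p.2.2) else (p.1 ∘ Equiv.swap i j, Equiv.swap i j p.2.2,
          Equiv.swap i j p.2.1) : Site 4 × Fin 4 × Fin 4)).2.2)).trace.re) :=
        Finset.sum_congr rfl fun p _ => by rw [re_tr_plaquette_swapCfg ρ hρ U p]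
    _ = ∑ p ∈ plaquettesIn (box 4 L), ((N : ℝ) - (ρ (ZdGaugeConfig.plaquette U p.1 p.2.1
          p.2.2)).trace.re) :=
        Finset.sum_nbij' (fun p : Site 4 × Fin 4 × Fin 4 => (if Equiv.swap i j p.2.1 < Equiv.swap
            i j p.2.2 then (p.1 ∘ Equiv.swap i j, Equiv.swap i j p.2.1, Equiv.swap i j p.2.2) else
            (p.1 ∘ Equiv.swap i j, Equiv.swap i j p.2.2, Equiv.swap i j p.2.1) : Site 4 × Fin 4 ×
            Fin 4)) (fun p : Site 4 × Fin 4 × Fin 4 => (if Equiv.swap i j p.2.1 < Equiv.swap i j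
            p.2.2 then (p.1 ∘ Equiv.swap i j, Equiv.swap i j p.2.1, Equiv.swap i j p.2.2) else
            (p.1 ∘ Equiv.swap i j, Equiv.swap i j p.2.2, Equiv.swap i j p.2.1) : Site 4 × Fin 4 ×
            Fin 4))
          (fun p hp => reflPlaq_mem_plaquettesIn i j hp) (fun p hp => reflPlaq_mem_plaquettesIn i
              j hp)
          (fun p hp => reflPlaq_reflPlaq i j (mem_plaquettesIn_iff.1 hp).2.1)
          (fun p hp => reflPlaq_reflPlaq i j (mem_plaquettesIn_iff.1 hp).2.1) (fun p _ => rfl)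

variable [MeasurableSpace G] [BorelSpace G]

/-- **`dg_∞` is `Θ`-invariant**: `∫ H ∘ Θ dg_∞ = ∫ H dg_∞` for EVERY `H` — `Θ` is the coordinate
relabelling of the i.i.d. product `dg_∞` by the edge involution `(x, k) ↦ (x ∘ swap i j, swap i j
k)`, a measure-preserving measurable equivalence (Mathlib's `Measure.infinitePi_map_piCongrLeft`,
`MeasurePreserving.integral_comp'`). [folklore] -/
theorem integral_comp_swapCfg_zdHaar (i j : Fin 4) {E : Type*} [NormedAddCommGroup E]
    [NormedSpace ℝ E] (H : ZdGaugeConfig 4 G → E) :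
    ∫ U, H (fun e : Site 4 × Fin 4 => U (e.1 ∘ Equiv.swap i j, Equiv.swap i j e.2)) ∂zdHaar 4 G =
      ∫ U, H U ∂zdHaar 4 G := by
  have hθ : Function.Involutive (fun e : Site 4 × Fin 4 => (e.1 ∘ Equiv.swap i j, Equiv.swap i j
      e.2)) := fun e => reflEdge_reflEdge i j e
  set π : Equiv.Perm (Site 4 × Fin 4) := hθ.toPerm _ with hπ
  set Θ : ZdGaugeConfig 4 G ≃ᵐ ZdGaugeConfig 4 G :=
    MeasurableEquiv.piCongrLeft (fun _ : Site 4 × Fin 4 => G) π with hΘdef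
  have hΘ : ∀ U : ZdGaugeConfig 4 G,
      Θ U = fun e : Site 4 × Fin 4 => U (e.1 ∘ Equiv.swap i j, Equiv.swap i j e.2) := by
    intro U
    funext e
    simp only [hΘdef, MeasurableEquiv.coe_piCongrLeft, Equiv.piCongrLeft_apply_eq_cast, cast_eq,
      hπ, Function.Involutive.toPerm_symm, Function.Involutive.coe_toPerm]
  have hmp : MeasurePreserving Θ (zdHaar 4 G) (zdHaar 4 G) := by
    refine ⟨Θ.measurable, ?_⟩
    have h := Measure.infinitePi_map_piCongrLeft (X := fun _ : Site 4 × Fin 4 => G)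
      (fun _ : Site 4 × Fin 4 => haarProbability G) π
    exact h
  calc ∫ U, H (fun e : Site 4 × Fin 4 => U (e.1 ∘ Equiv.swap i j, Equiv.swap i j e.2)) ∂zdHaar 4 G
      = ∫ U, H (Θ U) ∂zdHaar 4 G := by simp only [hΘ]
    _ = ∫ U, H U ∂zdHaar 4 G := hmp.integral_comp' H

end SwapInvariance

/-! ## Support, measurability and size of the smeared curvature field -/

section Smeared

variable {G : Type}

/-- The action density at the origin is a function of the links of the six origin plaquettes
`(0, k), (e_k, l), (e_l, k), (0, l)`, `k < l`. [folklore] -/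
theorem dependsOn_actionDensity [Group G] {N : ℕ} (ρ : G →* Matrix (Fin N) (Fin N) ℂ) :
    DependsOn (actionDensity ρ) (((Finset.univ.filter (fun p : Fin 4 × Fin 4 => p.1 <
        p.2)).biUnion (fun p : Fin 4 × Fin 4 => originPlaquetteSupport (d := 4) p.1 p.2) : Finset
        (Site 4 × Fin 4)) : Set (Site 4 × Fin 4)) := by
  intro U V h
  unfold actionDensity
  refine Finset.sum_congr rfl fun k _ => Finset.sum_congr rfl fun l _ => ?_
  by_cases hkl : k < l
  · simp only [hkl, ↓reduceIte]
    exact isCylinder_plaquetteObs_zero ρ k l fun e he => h e (Finset.mem_coe.2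
      (Finset.mem_biUnion.2 ⟨(k, l), Finset.mem_filter.2 ⟨Finset.mem_univ _, hkl⟩, he⟩))
  · simp only [hkl, ↓reduceIte]

/-- The links of the six origin plaquettes translated to a site of level `x i - x j ≥ 1` have both
endpoints in the closed positive half `y j ≤ y i`. [folklore] -/
theorem posE_of_mem_originPlaquetteSupport_add {i j : Fin 4} {x : Site 4} (hx : 1 ≤ x i - x j)
    {e : Site 4 × Fin 4} (he : e ∈ ((Finset.univ.filter (fun p : Fin 4 × Fin 4 => p.1 <
        p.2)).biUnion (fun p : Fin 4 × Fin 4 => originPlaquetteSupport (d := 4) p.1 p.2) : Finset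
        (Site 4 × Fin 4))) :
    (e.1 + x : Site 4) j ≤ (e.1 + x : Site 4) i ∧ (e.1 + x + Pi.single e.2 (1 : ℤ) : Site 4) j ≤
      (e.1 + x + Pi.single e.2 (1 : ℤ) : Site 4) i := by
  simp only [Finset.mem_biUnion, Finset.mem_filter, Finset.mem_univ, true_and] at he
  obtain ⟨⟨k, l⟩, hkl, he⟩ := he
  simp only [originPlaquetteSupport, Finset.mem_insert, Finset.mem_singleton] at he
  dsimp only at hkl
  rcases he with rfl | rfl | rfl | rfl <;>
    simp only [Pi.add_apply, Pi.zero_apply, Pi.single_apply] <;> split_ifs <;> omega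

/-- A site contributing to the smearing sum of a test function supported in `{δ ≤ z i - z j}` at
spacing `0 < a ≤ δ` has level `x i - x j ≥ 1`. [folklore] -/
theorem one_le_level_of_apply_ne_zero {i j : Fin 4} {a δ : ℝ} (ha : 0 < a) (haδ : a ≤ δ)
    {g : 𝓢(EuclideanSpace ℝ (Fin 4), ℝ)}
    (hg : ∀ z ∈ tsupport (g : EuclideanSpace ℝ (Fin 4) → ℝ), δ ≤ z i - z j) {x : Site 4}
    (hx : g (a • siteToE x) ≠ 0) : 1 ≤ x i - x j := by
  have h1 := hg _ (subset_tsupport _ (Function.mem_support.2 hx))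
  simp only [PiLp.smul_apply, siteToE_apply, smul_eq_mul] at h1
  have h2 : a * 1 ≤ a * ((x i - x j : ℤ) : ℝ) := by
    rw [mul_one, Int.cast_sub, mul_sub]
    exact haδ.trans h1
  exact_mod_cast le_of_mul_le_mul_left h2 ha

variable [MeasurableSpace G]

/-- Translating the configuration by `-x` reads the link `e` at `(e.1 + x, e.2)`. [folklore] -/
theorem configShift_neg_apply (x : Site 4) (U : LGConfig 4 G) (e : Site 4 × Fin 4) :
    Literature.MathematicalPhysics.QuantumLattice.configShift (-x) U e = U (e.1 + x, e.2) := by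
  rw [Literature.MathematicalPhysics.QuantumLattice.configShift_apply, sub_neg_eq_add]

/-- The smeared field (with `c = 1`, `m = 0`), unfolded. [folklore] -/
theorem smearedLatticeField_one_zero (O : LGConfig 4 G → ℝ) (Λ : Finset (Site 4)) (a : ℝ)
    (f : 𝓢(EuclideanSpace ℝ (Fin 4), ℝ)) (U : LGConfig 4 G) :
    smearedLatticeField O Λ a 1 0 f U = a ^ 4 * ∑ x ∈ Λ, f (a • siteToE x) * O
      (Literature.MathematicalPhysics.QuantumLattice.configShift (-x) U) := by
  simp only [smearedLatticeField, one_mul, sub_zero]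

end Smeared

end SwapRP

/-- **`Θ`-invariance of the free-boundary Wilson expectation on the cube `{-L,…,L}⁴`**:
`⟨F ∘ Θ⟩_{Λ_L,β} = ⟨F⟩_{Λ_L,β}` for every `F : (ℤ⁴-links → G) → ℝ`, where
`(ΘU)(x, k) = U(x ∘ swap i j, swap i j k)`. The expectation is the ratio
`∫ F e^{-βS_Λ} dg_∞ / ∫ e^{-βS_Λ} dg_∞`; the Wilson action of the swap-symmetric box is
`Θ`-invariant and `Θ` is a measure-preserving measurable equivalence of `dg_∞` (relabelling of an
i.i.d. product by an involution of the index set), so the numerator is unchanged — no measurability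
or integrability of `F` is needed (REGISTERED signature). [folklore] -/
theorem ZdExpectSwapInvariant : ∀ {G : Type*} [Group G] [TopologicalSpace G] [IsTopologicalGroup G] [CompactSpace G] [T2Space G] [SecondCountableTopology G] [MeasurableSpace G] [BorelSpace G] {N : ℕ} (ρ : G →* Matrix (Fin N) (Fin N) ℂ), Continuous ρ → (∀ g, ρ g ∈ Matrix.unitaryGroup (Fin N) ℂ) → ∀ (i j : Fin 4) (β : ℝ) (L : ℕ) (F : Literature.MathematicalPhysics.QuantumFieldTheory.ZdGaugeConfig 4 G → ℝ), Literature.MathematicalPhysics.QuantumFieldTheory.zdExpect ρ β (Literature.Probability.LatticeModels.box 4 L) (fun U => F (fun e : Literature.MathematicalPhysics.QuantumLattice.ZdEdge 4 => U (e.1 ∘ Equiv.swap i j, Equiv.swap i j e.2))) = Literature.MathematicalPhysics.QuantumFieldTheory.zdExpect ρ β (Literature.Probability.LatticeModels.box 4 L) F := by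
  intro G _ _ _ _ _ _ _ _ N ρ hρ _ i j β L F
  rw [AreaLaw.zdExpect_eq_div_integral ρ hρ β (box 4 L),
    AreaLaw.zdExpect_eq_div_integral ρ hρ β (box 4 L) F]
  congr 1
  calc ∫ U, F (fun e : Site 4 × Fin 4 => U (e.1 ∘ Equiv.swap i j, Equiv.swap i j e.2)) *
        Real.exp (-β * zdWilsonAction ρ (box 4 L) U) ∂zdHaar 4 G
      = ∫ U, (fun V : ZdGaugeConfig 4 G => F V * Real.exp (-β * zdWilsonAction ρ (box 4 L) V))
          (fun e : Site 4 × Fin 4 => U (e.1 ∘ Equiv.swap i j, Equiv.swap i j e.2)) ∂zdHaar 4 G := by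
        refine integral_congr_ae (ae_of_all _ fun U => ?_)
        simp only [SwapRP.zdWilsonAction_swapCfg ρ hρ i j L U]
    _ = _ := SwapRP.integral_comp_swapCfg_zdHaar i j (fun V : ZdGaugeConfig 4 G => F V *
        Real.exp (-β * zdWilsonAction ρ (box 4 L) V))

/-- **The smeared curvature field of a positively supported test function lives on positive
links.** For `0 < a ≤ δ` and a test function `g` supported in `{z i - z j ≥ δ}`, the smeared
curvature field `a⁴ ∑_{x ∈ Λ_L} g(a x) F(τₓ U)` (`F` the action density at the origin) depends only
on a finite set of links with both endpoints in the closed half `y j ≤ y i` (a contributing site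
has `a (x i - x j) ≥ δ ≥ a`, so level `≥ 1`, and the links of the six origin plaquettes translated
to `x` lose at most one level), is measurable, and is bounded by `a⁴ ∑_x |g(a x)| · C` whenever
`|F| ≤ C` (REGISTERED signature). [folklore] -/
theorem SmearedPositiveHalfSupport : ∀ {G : Type} [Group G] [TopologicalSpace G] [IsTopologicalGroup G] [CompactSpace G] [MeasurableSpace G] [BorelSpace G] (r : Literature.MathematicalPhysics.QuantumFieldTheory.LatticeRep G) (i j : Fin 4), i ≠ j → ∀ (L : ℕ) (a δ : ℝ), 0 < a → a ≤ δ → ∀ (g : SchwartzMap (EuclideanSpace ℝ (Fin 4)) ℝ), (∀ z ∈ tsupport (g : EuclideanSpace ℝ (Fin 4) → ℝ), δ ≤ z i - z j) → (∃ B : Finset (Literature.MathematicalPhysics.QuantumLattice.ZdEdge 4), (∀ e ∈ B, e.1 j ≤ e.1 i ∧ (e.1 + Pi.single e.2 (1 : ℤ) : Literature.Probability.LatticeModels.Site 4) j ≤ (e.1 + Pi.single e.2 (1 : ℤ) : Literature.Probability.LatticeModels.Site 4) i) ∧ DependsOn (Literature.MathematicalPhysics.QuantumFieldTheory.smearedLatticeField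 r.curvature.F (Literature.Probability.LatticeModels.box 4 L) a 1 0 g) (B : Set (Literature.MathematicalPhysics.QuantumLattice.ZdEdge 4))) ∧ Measurable (Literature.MathematicalPhysics.QuantumFieldTheory.smearedLatticeField r.curvature.F (Literature.Probability.LatticeModels.box 4 L) a 1 0 g) ∧ ∀ (C : ℝ), (∀ U, |r.curvature.F U| ≤ C) → ∀ U, |Literature.MathematicalPhysics.QuantumFieldTheory.smearedLatticeField r.curvature.F (Literature.Probability.LatticeModels.box 4 L) a 1 0 g U| ≤ (a ^ 4 * ∑ x ∈ Literature.Probability.LatticeModels.box 4 L, |g (a • Literature.MathematicalPhysics.QuantumLattice.siteToE x)|) * C := by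
  intro G _ _ _ _ _ _ r i j _ L a δ ha haδ g hg
  have hF : r.curvature.F = actionDensity r.ρ := rfl
  refine ⟨?_, ?_, ?_⟩
  · -- support on positive links
    set S : Finset (Site 4 × Fin 4) := (Finset.univ.filter (fun p : Fin 4 × Fin 4 => p.1 <
        p.2)).biUnion (fun p : Fin 4 × Fin 4 => originPlaquetteSupport (d := 4) p.1 p.2) with hS
    refine ⟨((box 4 L).filter (fun x => g (a • siteToE x) ≠ 0)).biUnion (fun x => S.image (fun e :
        Site 4 × Fin 4 => (e.1 + x, e.2))), ?_, ?_⟩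
    · intro e he
      simp only [Finset.mem_biUnion, Finset.mem_filter, Finset.mem_image] at he
      obtain ⟨x, ⟨-, hx⟩, b, hb, rfl⟩ := he
      exact SwapRP.posE_of_mem_originPlaquetteSupport_add
        (SwapRP.one_le_level_of_apply_ne_zero ha haδ hg hx) hb
    · intro U V hUV
      rw [SwapRP.smearedLatticeField_one_zero, SwapRP.smearedLatticeField_one_zero]
      congr 1
      refine Finset.sum_congr rfl fun x hx => ?_
      by_cases h0 : g (a • siteToE x) = 0
      · rw [h0, zero_mul, zero_mul]
      · congr 1
        rw [hF]
        refine SwapRP.dependsOn_actionDensity r.ρ fun e he => ?_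
        rw [SwapRP.configShift_neg_apply, SwapRP.configShift_neg_apply]
        refine hUV _ (Finset.mem_coe.2 (Finset.mem_biUnion.2 ⟨x, Finset.mem_filter.2 ⟨hx, h0⟩,
          Finset.mem_image.2 ⟨e, Finset.mem_coe.1 he, rfl⟩⟩))
  · -- measurability
    have hm : Measurable r.curvature.F := r.curvature.measurable
    have h : (smearedLatticeField r.curvature.F (box 4 L) a 1 0 g) = fun U => a ^ 4 * ∑ x ∈ box 4
        L, g (a • siteToE x) * r.curvature.F
          (Literature.MathematicalPhysics.QuantumLattice.configShift (-x) U) :=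
      funext fun U => SwapRP.smearedLatticeField_one_zero _ _ _ _ _
    rw [h]
    exact (Finset.measurable_sum _ fun x _ => (hm.comp
      (Literature.MathematicalPhysics.QuantumLattice.configShift (-x)).measurable).const_mul
        _).const_mul _
  · -- bound
    intro C hC U
    rw [SwapRP.smearedLatticeField_one_zero, abs_mul, abs_of_pos (pow_pos ha 4), mul_assoc,
      Finset.sum_mul]
    refine mul_le_mul_of_nonneg_left ((Finset.abs_sum_le_sum_abs _ _).trans
      (Finset.sum_le_sum fun x _ => ?_)) (pow_pos ha 4).le
    rw [abs_mul]
    exact mul_le_mul_of_nonneg_left (hC _) (abs_nonneg _)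

/-- **Translation covariance of the smeared field.** If `g'(a y) = g(a (y - w))` on the lattice and
every site `x` with `g(a x) ≠ 0` has `x, x + w ∈ Λ_L`, then smearing `O` against `g` on the
configuration translated by `w` equals smearing against `g'`:
`τₓ(translate w U) = τ_{x+w} U`, and the lattice sum is reindexed by `x ↦ x + w` on the support of
`g` (REGISTERED signature). [folklore] -/
theorem SmearedTranslate : ∀ {G : Type} [Group G] [MeasurableSpace G] (O : Literature.MathematicalPhysics.QuantumLattice.LGConfig 4 G → ℝ) (L : ℕ) (a c m : ℝ) (g g' : SchwartzMap (EuclideanSpace ℝ (Fin 4)) ℝ) (w : Literature.Probability.LatticeModels.Site 4), (∀ y : Literature.Probability.LatticeModels.Site 4, g' (a • Literature.MathematicalPhysics.QuantumLattice.siteToE y) = g (a • Literature.MathematicalPhysics.QuantumLattice.siteToE (y - w))) → (∀ x : Literature.Probability.LatticeModels.Site 4, g (a • Literature.MathematicalPhysics.QuantumLattice.siteToE x) ≠ 0 → x ∈ Literature.Probability.LatticeModels.box 4 L ∧ x + w ∈ Literature.Probability.LatticeModels.box 4 L) → ∀ U : Literature.MathematicalPhysics.QuantumLattice.LGConfig 4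 G, Literature.MathematicalPhysics.QuantumFieldTheory.smearedLatticeField O (Literature.Probability.LatticeModels.box 4 L) a c m g (Literature.MathematicalPhysics.QuantumFieldTheory.ZdGaugeConfig.translate w U) = Literature.MathematicalPhysics.QuantumFieldTheory.smearedLatticeField O (Literature.Probability.LatticeModels.box 4 L) a c m g' U := by
  intro G _ _ O L a c m g g' w hg' hsupp U
  have hshift : ∀ x : Site 4, Literature.MathematicalPhysics.QuantumLattice.configShift (-x)
      (ZdGaugeConfig.translate w U) =
        Literature.MathematicalPhysics.QuantumLattice.configShift (-(x + w)) U := by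
    intro x
    funext e
    rw [SwapRP.configShift_neg_apply, SwapRP.configShift_neg_apply]
    show U (e.1 + x + w, e.2) = U (e.1 + (x + w), e.2)
    rw [add_assoc]
  unfold smearedLatticeField
  congr 1
  simp only [hshift, hg']
  refine Finset.sum_bij_ne_zero (fun x _ _ => x + w) (fun x _ hx => ?_) (fun x _ _ y _ _ h => ?_)
    (fun y hy hne => ?_) (fun x _ _ => ?_)
  · exact (hsupp x (left_ne_zero_of_mul hx)).2
  · exact add_right_cancel h
  · refine ⟨y - w, (hsupp (y - w) (left_ne_zero_of_mul hne)).1, ?_, sub_add_cancel y w⟩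
    rwa [sub_add_cancel]
  · rw [add_sub_cancel_right]

end Summit.QuantumFields.YangMills.Theorems.CurvatureKernel

end
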